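import Mathlib
import HarnessLib
import Summits.PneNP.PneNP.Theorems.AeaCutRectanglesDutyRectangles

/-!
# Crux `FoolingMeasure` (stmt-PneNP-19727): HALF-SPARSE CORES — the sparse case (`|F| ≤ (8n-20)/3`) proved

Lead prover pnp-aea-p1 g2 (2026-08-27), route `AeaCutRectangles`.  The conditional refutation
`FoolingMeasure/Negative/FoolingMeasureFalseOfHalfSparseCore` reduces `¬X1` (X1 =
`Summit.PneNP.PneNP.Theses.AeaCutRectangles.FoolingMeasure`) to HALF-SPARSE CORE: every non-3-colourable graph over
`Fin n` has `≥ n/2` vertices spanning `≤ n/2` edges of some non-3-colourable subgraph.  This file is pure finite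
graph theory and PROVES that conclusion (`halfSparse_of_sparse_core`) for every loopless non-3-colourable edge set
`F` with one colour-critical edge `e` (`F ∖ e` 3-colourable — every inclusion-minimal non-3-colourable subgraph
qualifies) and `3|F| + 20 ≤ 8n`, by the COLOUR-CLASS ARGUMENT: 3-colour `F ∖ e`; either a colour class has
`≥ ⌈n/2⌉` vertices (it spans only `e`), or every union of two classes has `≥ ⌈n/2⌉` vertices and, by AVERAGING
over its `⌈n/2⌉`-subsets (`exists_subset_few_edges`: an `s`-set carrying a loopless edge set `E` has an `h`-subset
spanning `≤ |E|·h(h-1)/(s(s-1))` edges — delete a max-degree vertex `s-h` times; handshake `sum_deg_eq`), one of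
the three unions yields a half with `≤ n/2` edges: the three unions have sizes summing to `2n` (so
`Σ s_k(s_k-1) ≥ 4n²/3 - 2n`) and carry `≤ |F| + 2` edges in total (properly coloured edges lie in one union, `e`
in at most three), while `4h(h-1) ≤ n² - 1`; the inequality closes exactly when `3|F| + 20 ≤ 8n`.

Used by `AeaCutRectanglesSparseCores` (X1 restricted to supports with a 4-critical core of `≤ (8n-20)/3` edges,
or with `≤ (8n-20)/3` edges altogether, is false).  HALF-SPARSE CORE thus remains open exactly for 4-critical
graphs of average degree `> 16/3` relative to `n`.

HONEST FRAMING: elementary extremal counting; FRONTIER material for a rung of Fagin's complement ladder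
(NON-3-COL vs ESO(∀∃∀)); restricted-model witness — nothing here bears on P vs NP.
-/

set_option linter.dupNamespace false
set_option autoImplicit false

namespace Summit.PneNP.PneNP.Theorems.AeaCutRectanglesSparseCoreLemma

open Finset
open Summit.PneNP.PneNP.Theorems.AeaCutRectanglesDutyRectangles

/-! ### Averaging: a sparse `h`-subset -/

section Averaging

variable {V : Type*} [Fintype V] [DecidableEq V]

omit [Fintype V] in
/-- The vertices of `U` on a non-loop edge inside `U` are exactly its two endpoints. -/
theorem card_filter_mem_edge (U : Finset V) {e : Sym2 V} (hd : ¬ e.IsDiag) (hU : ∀ v ∈ e, v ∈ U) :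
    (U.filter (fun v => v ∈ e)).card = 2 := by
  induction e using Sym2.ind with
  | h a b =>
    have hab : a ≠ b := fun h => hd (Sym2.mk_isDiag_iff.2 h)
    have : U.filter (fun v => v ∈ s(a, b)) = {a, b} := by
      ext v
      simp only [mem_filter, Sym2.mem_iff, mem_insert, mem_singleton]
      constructor
      · rintro ⟨-, h⟩; exact h
      · rintro (rfl | rfl)
        · exact ⟨hU _ (Sym2.mem_mk_left _ _), Or.inl rfl⟩
        · exact ⟨hU _ (Sym2.mem_mk_right _ _), Or.inr rfl⟩
    rw [this, card_pair hab]

omit [Fintype V] in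
/-- Handshake: the degrees inside `U` of a loopless edge set inside `U` sum to twice the number of edges. -/
theorem sum_deg_eq (U : Finset V) (E : Finset (Sym2 V))
    (hE : ∀ e ∈ E, ¬ e.IsDiag ∧ ∀ v ∈ e, v ∈ U) :
    ∑ v ∈ U, (E.filter (fun e => v ∈ e)).card = 2 * E.card := by
  simp_rw [card_filter]
  rw [sum_comm]
  have : ∀ e ∈ E, (∑ v ∈ U, if v ∈ e then 1 else 0) = 2 := by
    intro e he
    rw [← card_filter]
    exact card_filter_mem_edge U (hE e he).1 (hE e he).2
  rw [sum_congr rfl this, sum_const, smul_eq_mul, mul_comm]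

omit [Fintype V] in
/-- Some vertex has at least average degree: `2|E| ≤ |U|·deg(v)`. -/
theorem exists_deg_ge (U : Finset V) (E : Finset (Sym2 V)) (hU : U.Nonempty)
    (hE : ∀ e ∈ E, ¬ e.IsDiag ∧ ∀ v ∈ e, v ∈ U) :
    ∃ v ∈ U, 2 * E.card ≤ U.card * (E.filter (fun e => v ∈ e)).card := by
  by_contra h
  push Not at h
  have hlt : ∑ v ∈ U, U.card * (E.filter (fun e => v ∈ e)).card < ∑ _v ∈ U, 2 * E.card :=
    sum_lt_sum_of_nonempty hU fun v hv => h v hv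
  rw [← mul_sum, sum_deg_eq U E hE, sum_const, smul_eq_mul] at hlt
  exact lt_irrefl _ hlt

/-- **Averaging.**  A loopless edge set `E` inside a vertex set `U` of size `s ≥ h` admits an `h`-subset `S ⊆ U`
spanning at most the fraction `h(h-1)/(s(s-1))` of the edges: `|E[S]|·s(s-1) ≤ |E|·h(h-1)`  (delete a vertex
of maximum degree `s - h` times). -/
theorem exists_subset_few_edges (h : ℕ) :
    ∀ (s : ℕ) (U : Finset V) (E : Finset (Sym2 V)), U.card = s → h ≤ s →
      (∀ e ∈ E, ¬ e.IsDiag ∧ ∀ v ∈ e, v ∈ U) →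
      ∃ S, S ⊆ U ∧ S.card = h ∧ (bobSide S E).card * (s * (s - 1)) ≤ E.card * (h * (h - 1)) := by
  intro s
  induction s using Nat.strong_induction_on with
  | _ s ih =>
    intro U E hUs hhs hE
    by_cases hs : s = h
    · subst hs
      refine ⟨U, Subset.refl _, hUs, Nat.mul_le_mul_right _ (card_le_card (filter_subset _ _))⟩
    · have hs1 : h + 1 ≤ s := by omega
      have hUne : U.Nonempty := by
        rw [← card_pos, hUs]; omega
      obtain ⟨v, hvU, hdeg⟩ := exists_deg_ge U E hUne hE
      set U' : Finset V := U.erase v with hU'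
      set E' : Finset (Sym2 V) := E.filter (fun e => v ∉ e) with hE'
      have hU's : U'.card = s - 1 := by rw [hU', card_erase_of_mem hvU, hUs]
      have hE'in : ∀ e ∈ E', ¬ e.IsDiag ∧ ∀ w ∈ e, w ∈ U' := by
        intro e he
        obtain ⟨heE, hve⟩ := mem_filter.1 he
        refine ⟨(hE e heE).1, fun w hw => mem_erase.2 ⟨?_, (hE e heE).2 w hw⟩⟩
        rintro rfl; exact hve hw
      obtain ⟨S, hSU', hSh, hle⟩ := ih (s - 1) (by omega) U' E' hU's (by omega) hE'in
      have hSU : S ⊆ U := hSU'.trans (erase_subset _ _)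
      have hvS : v ∉ S := fun hv => (mem_erase.1 (hSU' hv)).1 rfl
      -- edges of E inside S avoid v, so they are edges of E'
      have hbob : bobSide S E = bobSide S E' := by
        ext e
        simp only [mem_bobSide, hE', mem_filter]
        constructor
        · rintro ⟨heE, hin⟩
          exact ⟨⟨heE, fun hv => hvS (hin v hv)⟩, hin⟩
        · rintro ⟨⟨heE, -⟩, hin⟩
          exact ⟨heE, hin⟩
      -- |E'| = |E| - deg v
      have hcardE' : E'.card + (E.filter (fun e => v ∈ e)).card = E.card := by
        rw [hE']
        have := card_filter_add_card_filter_not (s := E) (fun e => v ∉ e)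
        simpa using this
      refine ⟨S, hSU, hSh, ?_⟩
      rw [hbob]
      -- arithmetic: hle : b·(s-1)(s-2) ≤ |E'|·h(h-1);  (s)·deg ≥ 2|E|;  want b·s(s-1) ≤ |E|·h(h-1)
      rw [hUs] at hdeg
      set b := (bobSide S E').card
      set d := (E.filter (fun e => v ∈ e)).card
      set a := E.card
      set a' := E'.card
      have hs2 : 2 ≤ s ∨ s = 1 := by omega
      rcases hs2 with hs2 | hs1'
      · -- from hle: b (s-1)(s-2) ≤ a' h(h-1); multiply by s: b (s-1)(s-2) s ≤ a' s h(h-1) ≤ (a s - 2a) h(h-1)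
        -- = a (s-2) h(h-1); cancel (s-2) if s ≥ 3; if s = 2 then h ≤ 1 and b = 0.
        rcases Nat.lt_or_ge 2 s with hs3 | hs3
        · have key : b * (s - 1) * (s - 2) * s ≤ a * (s - 2) * (h * (h - 1)) := by
            have e1 : (s - 1 - 1) = s - 2 := by omega
            have h1 : b * ((s - 1) * (s - 2)) * s ≤ a' * (h * (h - 1)) * s := by
              rw [← e1]; exact Nat.mul_le_mul_right _ hle
            have h2 : a' * s ≤ a * (s - 2) := by
              have hsum' : a' + d = a := hcardE'
              have h3 : 2 * a ≤ s * d := hdeg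
              have hs2' : 2 ≤ s := le_of_lt hs3
              zify [hs2']
              have e1 : ((a' : ℕ) : ℤ) = a - d := by
                have := congrArg (fun x : ℕ => (x : ℤ)) hsum'
                push_cast at this
                linarith
              have h3' : (2 : ℤ) * a ≤ (s : ℤ) * d := by exact_mod_cast h3
              rw [e1]
              nlinarith
            calc b * (s - 1) * (s - 2) * s = b * ((s - 1) * (s - 2)) * s := by ring
              _ ≤ a' * (h * (h - 1)) * s := h1
              _ = a' * s * (h * (h - 1)) := by ring
              _ ≤ a * (s - 2) * (h * (h - 1)) := Nat.mul_le_mul_right _ h2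
          have hpos : 0 < s - 2 := by omega
          have : b * (s * (s - 1)) * (s - 2) ≤ a * (h * (h - 1)) * (s - 2) := by
            calc b * (s * (s - 1)) * (s - 2) = b * (s - 1) * (s - 2) * s := by ring
              _ ≤ a * (s - 2) * (h * (h - 1)) := key
              _ = a * (h * (h - 1)) * (s - 2) := by ring
          exact Nat.le_of_mul_le_mul_right this hpos
        · -- s = 2, so h ≤ 1: no edge lies inside a set of ≤ 1 vertices
          have hh : h ≤ 1 := by omega
          have hb0 : b = 0 := by
            rw [show b = (bobSide S E').card from rfl, card_eq_zero]
            refine eq_empty_of_forall_notMem fun e he => ?_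
            obtain ⟨heE', hin⟩ := mem_bobSide.1 he
            have hd := (hE'in e heE').1
            induction e using Sym2.ind with
            | h x y =>
              have hxy : x ≠ y := fun hxy => hd (Sym2.mk_isDiag_iff.2 hxy)
              have hx := hin x (Sym2.mem_mk_left _ _)
              have hy := hin y (Sym2.mem_mk_right _ _)
              have : ({x, y} : Finset V).card ≤ S.card := card_le_card (by
                intro z hz; simp only [mem_insert, mem_singleton] at hz
                rcases hz with rfl | rfl <;> assumption)
              rw [card_pair hxy, hSh] at this
              omega
          rw [hb0]; simp
      · subst hs1'
        simp

end Averaging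

/-! ### The colour-class argument: half-sparse cores for `|F| ≤ (8n-20)/3` -/

/-- Colourings avoiding the killing set of `F ∖ e` are proper on every other edge of `F`. -/
theorem ne_of_not_mem_killSet_erase {n : ℕ} {F : Finset (Sym2 (Fin n))} {e : Sym2 (Fin n)}
    {c : Fin n → Fin 3} (hc : c ∉ killSet (F.erase e)) {e' : Sym2 (Fin n)} (he' : e' ∈ F) (hne : e' ≠ e)
    (hd : ¬ e'.IsDiag) : ¬ (e'.map c).IsDiag :=
  fun hm => hc ⟨e', mem_erase.2 ⟨hne, he'⟩, hd, hm⟩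

/-- **Half-sparse cores, sparse case.**  Let `F` be a loopless non-3-colourable edge set over `Fin n` (`n ≥ 2`)
with an edge `e` such that `F ∖ e` is 3-colourable, and `3|F| + 20 ≤ 8n`.  Then some vertex set `S` with
`2|S| ≥ n` spans at most `n/2` edges of `F` (`2·|bobSide S F| ≤ n`). -/
theorem halfSparse_of_sparse_core {n : ℕ} (hn : 2 ≤ n) (F : Finset (Sym2 (Fin n)))
    (hl : ∀ e ∈ F, ¬ e.IsDiag)
    (hF : ¬ (SimpleGraph.fromEdgeSet (F : Set (Sym2 (Fin n)))).Colorable 3)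
    {e : Sym2 (Fin n)} (he : e ∈ F)
    (hFe : (SimpleGraph.fromEdgeSet ((F.erase e : Finset (Sym2 (Fin n))) : Set (Sym2 (Fin n)))).Colorable 3)
    (hm : 3 * F.card + 20 ≤ 8 * n) :
    ∃ S : Finset (Fin n), n ≤ 2 * S.card ∧ 2 * (bobSide S F).card ≤ n := by
  classical
  obtain ⟨c, hc⟩ := (colorable_iff_exists_not_mem_killSet _).1 hFe
  -- `e` itself is monochromatic under `c` (else `c` would colour `F`)
  have hemono : (e.map c).IsDiag := by
    by_contra hne
    apply hF
    rw [colorable_iff_exists_not_mem_killSet]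
    refine ⟨c, ?_⟩
    rintro ⟨e', he', hd', hm'⟩
    by_cases h : e' = e
    · subst h; exact hne hm'
    · exact ne_of_not_mem_killSet_erase hc he' h hd' hm'
  set h : ℕ := (n + 1) / 2 with hh
  set X : Fin 3 → Finset (Fin n) := fun k => univ.filter (fun v => c v = k) with hX
  -- an edge of F inside a single colour class is `e`
  have inside_class : ∀ k, ∀ e' ∈ bobSide (X k) F, e' = e := by
    intro k e' he'
    obtain ⟨he'F, hin⟩ := mem_bobSide.1 he'
    by_contra hne
    apply ne_of_not_mem_killSet_erase hc he'F hne (hl e' he'F)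
    induction e' using Sym2.ind with
    | h a b =>
      have ha := (mem_filter.1 (hin a (Sym2.mem_mk_left _ _))).2
      have hb := (mem_filter.1 (hin b (Sym2.mem_mk_right _ _))).2
      exact (map_mk_isDiag_iff c a b).2 (ha.trans hb.symm)
  by_cases hbig : ∃ k, h ≤ (X k).card
  · -- Case A: a big colour class spans only `e`
    obtain ⟨k, hk⟩ := hbig
    refine ⟨X k, by omega, ?_⟩
    have : (bobSide (X k) F).card ≤ 1 := by
      rw [Finset.card_le_one]
      intro a ha b hb
      rw [inside_class k a ha, inside_class k b hb]
    omega
  · -- Case B: every class has < h vertices; average over h-subsets of the two-class unions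
    push Not at hbig
    have hXcard : ∑ k, (X k).card = n := by
      have := (Finset.card_eq_sum_card_fiberwise (s := (univ : Finset (Fin n))) (t := (univ : Finset (Fin 3)))
        (f := c) (fun _ _ => mem_univ _)).symm
      simpa [hX] using this
    -- U k := complement of class k
    set U : Fin 3 → Finset (Fin n) := fun k => univ.filter (fun v => c v ≠ k) with hU
    have hUX : ∀ k, (X k).card + (U k).card = n := by
      intro k
      have := card_filter_add_card_filter_not (s := (univ : Finset (Fin n))) (fun v => c v = k)
      simpa only [card_univ, Fintype.card_fin] using this
    have hUge : ∀ k, h ≤ (U k).card := by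
      intro k; have h1 := hUX k; have h2 := hbig k; omega
    -- E k := edges of F inside U k; averaging gives S k
    have hEin : ∀ k, ∀ e' ∈ bobSide (U k) F, ¬ e'.IsDiag ∧ ∀ v ∈ e', v ∈ U k := by
      intro k e' he'
      obtain ⟨he'F, hin⟩ := mem_bobSide.1 he'
      exact ⟨hl e' he'F, hin⟩
    have hS : ∀ k, ∃ S, S ⊆ U k ∧ S.card = h ∧
        (bobSide S (bobSide (U k) F)).card * ((U k).card * ((U k).card - 1)) ≤
          (bobSide (U k) F).card * (h * (h - 1)) :=
      fun k => exists_subset_few_edges h _ (U k) (bobSide (U k) F) rfl (hUge k) (hEin k)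
    choose S hSU hSh hSle using hS
    -- edges of F inside S k are edges of (F inside U k) inside S k
    have hbobS : ∀ k, bobSide (S k) F ⊆ bobSide (S k) (bobSide (U k) F) := by
      intro k e' he'
      obtain ⟨he'F, hin⟩ := mem_bobSide.1 he'
      exact mem_bobSide.2 ⟨mem_bobSide.2 ⟨he'F, fun v hv => hSU k (hin v hv)⟩, hin⟩
    -- Σ_k |E k| ≤ |F| + 2 : the properly coloured edges split among the three unions, `e` is counted ≤ 3 times
    have hEsum : ∑ k, (bobSide (U k) F).card ≤ F.card + 2 := by
      -- the parts of F ∖ e inside the U k are pairwise disjoint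
      have hdisj : ((univ : Finset (Fin 3)) : Set (Fin 3)).PairwiseDisjoint
          (fun k => bobSide (U k) (F.erase e)) := by
        intro i _ j _ hij
        rw [Function.onFun, disjoint_left]
        intro e' hi hj
        obtain ⟨he'F, hin_i⟩ := mem_bobSide.1 hi
        obtain ⟨-, hin_j⟩ := mem_bobSide.1 hj
        obtain ⟨hne, he'F'⟩ := mem_erase.1 he'F
        apply ne_of_not_mem_killSet_erase hc he'F' hne (hl _ he'F')
        induction e' using Sym2.ind with
        | h a b =>
          have hai := (mem_filter.1 (hin_i a (Sym2.mem_mk_left _ _))).2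
          have hbi := (mem_filter.1 (hin_i b (Sym2.mem_mk_right _ _))).2
          have haj := (mem_filter.1 (hin_j a (Sym2.mem_mk_left _ _))).2
          have hbj := (mem_filter.1 (hin_j b (Sym2.mem_mk_right _ _))).2
          refine (map_mk_isDiag_iff c a b).2 (Fin.ext ?_)
          have hij' : (i : ℕ) ≠ j := fun h' => hij (Fin.ext h')
          have h1 := Fin.val_ne_of_ne hai; have h2 := Fin.val_ne_of_ne hbi
          have h3 := Fin.val_ne_of_ne haj; have h4 := Fin.val_ne_of_ne hbj
          have := (c a).isLt; have := (c b).isLt; have := i.isLt; have := j.isLt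
          omega
      have hsub : (univ : Finset (Fin 3)).biUnion (fun k => bobSide (U k) (F.erase e)) ⊆ F.erase e := by
        intro e' he'
        obtain ⟨k, -, hk⟩ := mem_biUnion.1 he'
        exact (mem_bobSide.1 hk).1
      have h1 : ∑ k, (bobSide (U k) (F.erase e)).card ≤ (F.erase e).card := by
        rw [← card_biUnion hdisj]
        exact card_le_card hsub
      have h2 : ∀ k, (bobSide (U k) F).card ≤ (bobSide (U k) (F.erase e)).card + 1 := by
        intro k
        have hsub' : bobSide (U k) F ⊆ insert e (bobSide (U k) (F.erase e)) := by
          intro e' he'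
          obtain ⟨he'F, hin⟩ := mem_bobSide.1 he'
          by_cases h' : e' = e
          · exact mem_insert.2 (Or.inl h')
          · exact mem_insert.2 (Or.inr (mem_bobSide.2 ⟨mem_erase.2 ⟨h', he'F⟩, hin⟩))
        exact (card_le_card hsub').trans (card_insert_le _ _)
      calc ∑ k, (bobSide (U k) F).card ≤ ∑ k, ((bobSide (U k) (F.erase e)).card + 1) :=
            sum_le_sum fun k _ => h2 k
        _ = ∑ k, (bobSide (U k) (F.erase e)).card + 3 := by
            rw [sum_add_distrib]; simp
        _ ≤ (F.erase e).card + 3 := by omega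
        _ = F.card + 2 := by rw [card_erase_of_mem he]; have := card_pos.2 ⟨e, he⟩; omega
    -- suppose every S k spans > n/2 edges of F and derive a contradiction
    by_contra hnone
    push Not at hnone
    have hSk : ∀ k, n + 1 ≤ 2 * (bobSide (S k) F).card := by
      intro k
      have := hnone (S k) (by rw [hSh]; omega)
      omega
    -- sizes
    have hsum_s : ∑ k, (U k).card = 2 * n := by
      have h3 : ∑ k : Fin 3, (X k).card + ∑ k : Fin 3, (U k).card = 3 * n := by
        rw [← sum_add_distrib, sum_congr rfl fun k _ => hUX k]
        simp
      omega
    -- main inequality per k: (n+1)·s_k(s_k-1) ≤ 2·|E_k|·h(h-1)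
    have hk : ∀ k, (n + 1) * ((U k).card * ((U k).card - 1)) ≤
        2 * (bobSide (U k) F).card * (h * (h - 1)) := by
      intro k
      have h1 := hSle k
      have h2 : (bobSide (S k) F).card ≤ (bobSide (S k) (bobSide (U k) F)).card := card_le_card (hbobS k)
      calc (n + 1) * ((U k).card * ((U k).card - 1))
          ≤ 2 * (bobSide (S k) F).card * ((U k).card * ((U k).card - 1)) :=
            Nat.mul_le_mul_right _ (hSk k)
        _ ≤ 2 * (bobSide (S k) (bobSide (U k) F)).card * ((U k).card * ((U k).card - 1)) := by
            gcongr
        _ = 2 * ((bobSide (S k) (bobSide (U k) F)).card * ((U k).card * ((U k).card - 1))) := by ring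
        _ ≤ 2 * ((bobSide (U k) F).card * (h * (h - 1))) := Nat.mul_le_mul_left _ h1
        _ = 2 * (bobSide (U k) F).card * (h * (h - 1)) := by ring
    -- sum over k and conclude with 3Σs² ≥ (Σs)² and 4h(h-1) ≤ n² - 1
    have hsum := Finset.sum_le_sum fun k (_ : k ∈ (univ : Finset (Fin 3))) => hk k
    rw [← mul_sum, ← sum_mul, ← mul_sum] at hsum
    -- name the three sizes
    have e3 : ∀ f : Fin 3 → ℕ, ∑ k, f k = f 0 + f 1 + f 2 := fun f => by
      simp [Fin.sum_univ_succ, add_assoc]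
    rw [e3, e3] at hsum
    rw [e3] at hsum_s hEsum
    set s0 := (U 0).card; set s1 := (U 1).card; set s2 := (U 2).card
    set E0 := (bobSide (U 0) F).card; set E1 := (bobSide (U 1) F).card; set E2 := (bobSide (U 2) F).card
    have hh2 : 2 * h ≤ n + 1 := by omega
    have hh1 : 1 ≤ h := by omega
    have hs0 : 1 ≤ s0 := le_trans hh1 (hUge 0)
    have hs1 : 1 ≤ s1 := le_trans hh1 (hUge 1)
    have hs2 : 1 ≤ s2 := le_trans hh1 (hUge 2)
    -- move to ℤ and chain the estimates
    zify [hs0, hs1, hs2, hh1] at hsum hsum_s hEsum hm hh2 hn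
    -- (1) 3·Σ s(s-1) ≥ 4n² - 6n
    have st1 : 4 * (n : ℤ) ^ 2 - 6 * n ≤
        3 * ((s0 : ℤ) * (s0 - 1) + (s1 : ℤ) * (s1 - 1) + (s2 : ℤ) * (s2 - 1)) := by
      nlinarith [sq_nonneg ((s0 : ℤ) - s1), sq_nonneg ((s1 : ℤ) - s2), sq_nonneg ((s0 : ℤ) - s2)]
    -- (2) 4·h(h-1) ≤ (n+1)(n-1)
    have st2 : 4 * ((h : ℤ) * (h - 1)) ≤ ((n : ℤ) + 1) * (n - 1) := by
      have e4 : 4 * ((h : ℤ) * (h - 1)) = (2 * (h : ℤ)) * (2 * h - 2) := by ring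
      rw [e4]
      exact mul_le_mul hh2 (by linarith) (by linarith) (by linarith)
    -- (3) (n+1)·Σ ≤ 2·(|F|+2)·h(h-1)
    have hH : (0 : ℤ) ≤ (h : ℤ) * (h - 1) := mul_nonneg (by positivity) (by linarith)
    have st3 : ((n : ℤ) + 1) * ((s0 : ℤ) * (s0 - 1) + (s1 : ℤ) * (s1 - 1) + (s2 : ℤ) * (s2 - 1)) ≤
        2 * ((F.card : ℤ) + 2) * ((h : ℤ) * (h - 1)) := by
      have := mul_le_mul_of_nonneg_right hEsum hH
      nlinarith
    -- (4) combine: 4(n+1)(4n²-6n) ≤ 12(n+1)Σ ≤ 24(|F|+2)h(h-1) ≤ 6(|F|+2)(n+1)(n-1) ≤ (16n-28)(n+1)(n-1)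
    have hF2 : (0 : ℤ) ≤ (F.card : ℤ) + 2 := by positivity
    have hn1 : (0 : ℤ) ≤ (n : ℤ) + 1 := by positivity
    have c1 : 4 * (((n : ℤ) + 1) * (4 * (n : ℤ) ^ 2 - 6 * n)) ≤
        6 * ((F.card : ℤ) + 2) * (((n : ℤ) + 1) * (n - 1)) := by
      have a1 := mul_le_mul_of_nonneg_left st1 hn1
      have a2 := mul_le_mul_of_nonneg_left st2 (mul_nonneg (by norm_num : (0:ℤ) ≤ 6) hF2)
      nlinarith
    have c2 : 6 * ((F.card : ℤ) + 2) ≤ 16 * (n : ℤ) - 28 := by linarith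
    have c3 : 6 * ((F.card : ℤ) + 2) * (((n : ℤ) + 1) * (n - 1)) ≤
        (16 * (n : ℤ) - 28) * (((n : ℤ) + 1) * (n - 1)) :=
      mul_le_mul_of_nonneg_right c2 (mul_nonneg hn1 (by linarith))
    have c4 : 4 * (((n : ℤ) + 1) * (4 * (n : ℤ) ^ 2 - 6 * n)) ≤
        (16 * (n : ℤ) - 28) * (((n : ℤ) + 1) * (n - 1)) := c1.trans c3
    -- i.e. (n+1)(20n - 28) ≤ 0, absurd for n ≥ 2
    nlinarith

end Summit.PneNP.PneNP.Theorems.AeaCutRectanglesSparseCoreLemma
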